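import Summits.BirchSwinnertonDyer.BirchSwinnertonDyer.Theorems.ByReductionTypeAtTwoAdditivePotMultConjATwoNarrowTwo18796Dyadic
import HarnessLib

/-!
# C4″ `AdditivePotMultOverKAtTwo` (item stmt-BirchSwinnertonDyer-22618), the (I1M′) input of the upper half on the `0 < Δ` rows:
# LAYER-TWO NARROW CERTIFICATE `d = 18796`, part RESIDUES — `π`-adic square classes in `A₁ = ℚ(θ) ⊔ ℚ_1` (`π = √2/(2 - θ)`, `e = 2`, `f = 1`):
# the unit `ε` is not a norm from `A₁(√(2+√2))`, and the totally positive unit `u₊` is not a square (KERNEL; rows 300736w1)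

Cell `bsd-2adic`, rung K4, seat `bsd-2adic-k4-w3` GEN 13 (explicit unit of director-bsd g16 (309)(7); `--supports stmt-BirchSwinnertonDyer-22618`).
HONEST FRAMING (D-0036/D-0054/D-0152): THEOREMS ONLY (no definition, no named fact, no `sorry`, no instance). The series `…NarrowTwo18796{Class, Field,
Dyadic, Residues, TotPos, Integers, Parity, SignsA/B/C, Units, Rows}` carries k4-w1 GEN 11's zero-hypothesis LAYER-TWO narrow certificate (row `261648q1`,
`…NarrowRankCertificate316*`: `h(A₁)`, `h(A₂)` odd by genus theory with one dyadic non-norm unit, ONE totally positive non-square unit of `A₁ = ℚ(θ,√2)`,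
ELEVEN sign-independent units of `A₂ = ℚ(θ,√(2+√2))`, k4-w2's Edgar–Mollin–Peterson door `a = 1, b = 11`, cruxlead-19573-w2's rung `m = 1`) to the
totally real cubic `2`-torsion field of discriminant `18796` (`X³ + (-1)X² + (-24)X + (46)`) of the C4″ census rows 300736w1 (eng-2 CERT-ADD-POTMULT-POS81-AB-E2:
`n₀ = 0`, `rank₂ Cl⁺ = [0,1,1]`, unit signature ranks `[3,5,11]`, `h = 1` at layers `0,1,2` — letter NARROW-EQUAL12, instrument grade `grh`; here KERNEL).
All certificates were found by the seat's exact-arithmetic tools (`k4w3/gen13/tools`: GEN 12 `narrowcert/unitlib` + layer-two arithmetic `nf12/cert2`) and are CHECKED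
HERE by the kernel. Statement (A) is NOT BSD: BSD₂ for these curves is not proved; C4″ / (I1M′) stay research-open; nothing booked; no row of 22618 changes tier
(pen RC-490 (4)); BSD is not proved by any of this.

References: [CoatesSujatha2005] Conj. A, Thm. 3.4; [Fukuda1994] Thm. 1 (2); [EdgarMollinPeterson1986] Thm. 2.1; [FrohlichTaylor1990] Ch. V §1 (1.8)–(1.13);
[Lang1990] Ch. 13 §4 Lemma 4.1; [Washington1997] §13.1, Prop. 13.2; [Cohen1993] §4.1.3, §6.3; [Marcus1977] Ch. 5 Thm. 22, 35–37; [Omeara1963] §63.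
-/

set_option autoImplicit false
-- sibling precedent: the directory name repeats the summit name
set_option linter.dupNamespace false

noncomputable section

open scoped Classical IntermediateField NumberField nonZeroDivisors Polynomial

namespace Summit.BirchSwinnertonDyer.BirchSwinnertonDyer.Theorems.AddKatoTwo

open Polynomial IsDedekindDomain NumberField Field IntermediateField
  Literature.NumberTheory.EllipticCurves Literature.NumberTheory.EllipticCurves.ZpExtension
  Literature.NumberTheory.IwasawaTheory Literature.NumberTheory.NumberFields
  Literature.NumberTheory.GaloisRepresentations Literature.Geometry.Kaehler.ComplexTorus

variable {θ : AlgebraicClosure ℚ}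

set_option linter.unusedSimpArgs false in
set_option maxHeartbeats 800000 in
/-- **`ε = -641 - 33 * θ + 17 * θ ^ 2` is NOT of the form `x² − (2 + √2)y²` with `x, y ∈ A₁ = ℚ(θ) ⊔ ℚ_1`** (`θ³ + (-1)θ² + (-24)θ + (46) = 0`, `d = 18796`) — it is not a norm from
`A₁(√(2+√2))`, the second cyclotomic layer: `2 + √2 = πμ` with `π = √2/(2 - θ)` prime (`e = 2`, `f = 1`), `π ∤ μ`, and `π⁴ ‖ ε − 1` (`ε ≡ 5 (mod 8)` at the
split dyadic prime); the tree's `not_exists_sq_sub_mul_sq_fractionRing_of_pow_four_dvd` (`(ε, 2+√2)_{(π)} = −1`). KERNEL. [cite: Omeara1963, §63B (63:10) and §63A (63:1)]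
[cite: NeukirchANT1999, Ch. V §3] -/
theorem not_exists_sq_sub_mul_sq_eq_eps_sup_layer_one_d18796 (hθ : aeval θ (Cubic.toPoly ⟨1, ((-1 : ℤ) : ℚ), ((-24 : ℤ) : ℚ), ((46 : ℤ) : ℚ)⟩) = 0)
    {t : AlgebraicClosure ℚ} (ht : t ∈ (CyclotomicZp.zpExtension 2).layer 1) (ht2 : t ^ 2 = 2) :
    ¬ ∃ x y : ↥(ℚ⟮θ⟯ ⊔ (CyclotomicZp.zpExtension 2).layer 1),
      x ^ 2 - (2 + ⟨t, (le_sup_right : (CyclotomicZp.zpExtension 2).layer 1 ≤ _) ht⟩) * y ^ 2 = inclusion (le_sup_left : ℚ⟮θ⟯ ≤ ℚ⟮θ⟯ ⊔ (CyclotomicZp.zpExtension 2).layer 1) (-641 - 33 * AdjoinSimple.gen ℚ θ + 17 * AdjoinSimple.gen ℚ θ ^ 2) := by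
  haveI : FiniteDimensional ℚ ↥ℚ⟮θ⟯ :=
    IntermediateField.adjoin.finiteDimensional ⟨_, Cubic.monic_of_a_eq_one', by rwa [← aeval_def]⟩
  haveI : FiniteDimensional ℚ ↥((CyclotomicZp.zpExtension 2).layer 1) := (CyclotomicZp.zpExtension 2).finiteDimensional_layer_holds 1
  haveI : NumberField ↥ℚ⟮θ⟯ := NumberField.mk
  haveI : NumberField ↥(ℚ⟮θ⟯ ⊔ (CyclotomicZp.zpExtension 2).layer 1) := NumberField.mk
  obtain ⟨bA, xA, sA, -, hbAval, hsAval, -, RbA, RxA, hs, -, hprime, hres, hnw, hnμ, -, -, -, -⟩ :=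
    layer_one_dyadic_d18796 hθ ht ht2
  obtain ⟨htwo, hwdef, -, hxmu, -, heps, hkap, -, -, -, -⟩ := layer_one_ids_d18796 bA xA RbA RxA
  set πA : 𝓞 ↥(ℚ⟮θ⟯ ⊔ (CyclotomicZp.zpExtension 2).layer 1) := xA with hπAdef
  have h2 : (2 : 𝓞 ↥(ℚ⟮θ⟯ ⊔ (CyclotomicZp.zpExtension 2).layer 1)) = πA ^ 2 * (4 - 4 * bA + bA ^ 2) := by linear_combination (-1 : 𝓞 ↥(ℚ⟮θ⟯ ⊔ (CyclotomicZp.zpExtension 2).layer 1)) * htwo + πA ^ 2 * hwdef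
  have h4 : πA ^ 4 ∣ (-641 - 33 * bA + 17 * bA ^ 2) - 1 := ⟨_, heps⟩
  have h5 : ¬ πA ^ 5 ∣ (-641 - 33 * bA + 17 * bA ^ 2) - 1 := by
    rintro ⟨c, hc⟩
    rw [heps, show πA ^ 5 * c = πA ^ 4 * (πA * c) by ring] at hc
    have hc' : 1388 - 349 * bA - 142 * bA ^ 2 = πA * c := mul_left_cancel₀ (pow_ne_zero 4 hprime.ne_zero) hc
    have h1 : πA ∣ 1 := ⟨c - (1003 * xA + 718 * bA * xA - 558 * bA ^ 2 * xA), by linear_combination hc' - hkap⟩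
    exact hprime.not_unit (isUnit_of_dvd_one h1)
  have key := not_exists_sq_sub_mul_sq_fractionRing_of_pow_four_dvd (↥(ℚ⟮θ⟯ ⊔ (CyclotomicZp.zpExtension 2).layer 1))
    hprime h2 hnw hres hnμ h4 h5
  have hm : algebraMap (𝓞 ↥(ℚ⟮θ⟯ ⊔ (CyclotomicZp.zpExtension 2).layer 1)) ↥(ℚ⟮θ⟯ ⊔ (CyclotomicZp.zpExtension 2).layer 1)
      (πA * (2 + 4 * xA - bA - 4 * bA * xA + bA ^ 2 * xA)) = 2 + ⟨t, (le_sup_right : (CyclotomicZp.zpExtension 2).layer 1 ≤ _) ht⟩ := by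
    rw [hxmu, hs, map_add, map_ofNat, ← hsAval]
  have he : algebraMap (𝓞 ↥(ℚ⟮θ⟯ ⊔ (CyclotomicZp.zpExtension 2).layer 1)) ↥(ℚ⟮θ⟯ ⊔ (CyclotomicZp.zpExtension 2).layer 1)
      (-641 - 33 * bA + 17 * bA ^ 2) = inclusion (le_sup_left : ℚ⟮θ⟯ ≤ ℚ⟮θ⟯ ⊔ (CyclotomicZp.zpExtension 2).layer 1) (-641 - 33 * AdjoinSimple.gen ℚ θ + 17 * AdjoinSimple.gen ℚ θ ^ 2) := by
    simp only [map_add, map_sub, map_mul, map_pow, map_zero, map_ofNat, map_neg, map_one, hbAval]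
  rintro ⟨x, y, h⟩
  exact key ⟨x, y, by rw [hm, he]; exact h⟩

set_option linter.unusedSimpArgs false in
set_option maxHeartbeats 800000 in
/-- **`u₊ = (-387137 + 110309 * θ + 35093 * θ ^ 2) + √2 * (288637 - 78774 * θ - 25503 * θ ^ 2)` is not the square of an INTEGER of `A₁ = ℚ(θ) ⊔ ℚ_1`**:
`u₊ = -387137 - 595864 * ω + 110309 * θ + 165887 * θ * ω + 35093 * θ ^ 2 + 53271 * θ ^ 2 * ω` in `ℤ[θ,ω]`; with `π = √2/(2 - θ)`: `u₊ − 1 = π^2(1 + π·…)` and `u₊ − (1 + π² + π³w) = π^3(1 + π·…)` (`2 = π²w`), so `u₊` is in neither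
class of unit squares modulo `π⁵` (tree `not_exists_sq_eq_of_not_pow_five_dvd`, `e = 2`, `f = 1`). KERNEL. [cite: Omeara1963, §63A (63:1a)] -/
theorem not_exists_sq_eq_uplus_sup_layer_one_d18796 (hθ : aeval θ (Cubic.toPoly ⟨1, ((-1 : ℤ) : ℚ), ((-24 : ℤ) : ℚ), ((46 : ℤ) : ℚ)⟩) = 0)
    {t : AlgebraicClosure ℚ} (ht : t ∈ (CyclotomicZp.zpExtension 2).layer 1) (ht2 : t ^ 2 = 2) :
    haveI : FiniteDimensional ℚ ↥ℚ⟮θ⟯ :=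
      IntermediateField.adjoin.finiteDimensional ⟨_, Cubic.monic_of_a_eq_one', by rwa [← aeval_def]⟩
    haveI : FiniteDimensional ℚ ↥((CyclotomicZp.zpExtension 2).layer 1) := (CyclotomicZp.zpExtension 2).finiteDimensional_layer_holds 1
    ¬ ∃ c : 𝓞 ↥(ℚ⟮θ⟯ ⊔ (CyclotomicZp.zpExtension 2).layer 1),
      ((c : 𝓞 ↥(ℚ⟮θ⟯ ⊔ (CyclotomicZp.zpExtension 2).layer 1)) : ↥(ℚ⟮θ⟯ ⊔ (CyclotomicZp.zpExtension 2).layer 1)) ^ 2 =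
        inclusion (le_sup_left : ℚ⟮θ⟯ ≤ ℚ⟮θ⟯ ⊔ (CyclotomicZp.zpExtension 2).layer 1) (-387137 + 110309 * AdjoinSimple.gen ℚ θ + 35093 * AdjoinSimple.gen ℚ θ ^ 2) + ⟨t, (le_sup_right : (CyclotomicZp.zpExtension 2).layer 1 ≤ _) ht⟩ * inclusion (le_sup_left : ℚ⟮θ⟯ ≤ ℚ⟮θ⟯ ⊔ (CyclotomicZp.zpExtension 2).layer 1) (288637 - 78774 * AdjoinSimple.gen ℚ θ - 25503 * AdjoinSimple.gen ℚ θ ^ 2) := by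
  haveI : FiniteDimensional ℚ ↥ℚ⟮θ⟯ :=
    IntermediateField.adjoin.finiteDimensional ⟨_, Cubic.monic_of_a_eq_one', by rwa [← aeval_def]⟩
  haveI : FiniteDimensional ℚ ↥((CyclotomicZp.zpExtension 2).layer 1) := (CyclotomicZp.zpExtension 2).finiteDimensional_layer_holds 1
  haveI : NumberField ↥ℚ⟮θ⟯ := NumberField.mk
  haveI : NumberField ↥(ℚ⟮θ⟯ ⊔ (CyclotomicZp.zpExtension 2).layer 1) := NumberField.mk
  obtain ⟨bA, xA, sA, -, hbAval, hsAval, -, RbA, RxA, hs, -, hprime, hres, hnw, -, -, -, -, -⟩ :=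
    layer_one_dyadic_d18796 hθ ht ht2
  obtain ⟨htwo, hwdef, -, -, -, -, -, -, -, -, -⟩ := layer_one_ids_d18796 bA xA RbA RxA
  obtain ⟨-, hu1, huq, hrho1, hrho2⟩ := layer_one_uplus_ids_d18796 bA xA RbA RxA
  set πA : 𝓞 ↥(ℚ⟮θ⟯ ⊔ (CyclotomicZp.zpExtension 2).layer 1) := xA with hπAdef
  have h2 : (2 : 𝓞 ↥(ℚ⟮θ⟯ ⊔ (CyclotomicZp.zpExtension 2).layer 1)) = πA ^ 2 * (4 - 4 * bA + bA ^ 2) := by linear_combination (-1 : 𝓞 ↥(ℚ⟮θ⟯ ⊔ (CyclotomicZp.zpExtension 2).layer 1)) * htwo + πA ^ 2 * hwdef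
  have hone : ∀ (z : 𝓞 ↥(ℚ⟮θ⟯ ⊔ (CyclotomicZp.zpExtension 2).layer 1)) (n : ℕ), ¬ πA ^ (n + 1) ∣ 1 + πA * z := by
    rintro z n hdvd
    obtain ⟨c, hc⟩ := (dvd_pow_self πA (Nat.succ_ne_zero n)).trans hdvd
    exact hprime.not_unit (isUnit_of_dvd_one ⟨c - z, by linear_combination hc⟩)
  set U : 𝓞 ↥(ℚ⟮θ⟯ ⊔ (CyclotomicZp.zpExtension 2).layer 1) := -387137 - 595864 * xA + 110309 * bA + 165887 * bA * xA + 35093 * bA ^ 2 + 53271 * bA ^ 2 * xA with hUdef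
  have hu : ¬ πA ∣ U := by
    rintro ⟨c, hc⟩
    exact hprime.not_unit (isUnit_of_dvd_one ⟨c - πA ^ 1 * (-889966 - 1331430 * xA + 248115 * bA + 371157 * bA * xA + 79630 * bA ^ 2 + 119125 * bA ^ 2 * xA), by linear_combination hc - hu1⟩)
  have hrho1' : -889966 - 1331430 * xA + 248115 * bA + 371157 * bA * xA + 79630 * bA ^ 2 + 119125 * bA ^ 2 * xA = 1 + πA * (-1331430 - 1992109 * xA + 371157 * bA + 555374 * bA * xA + 119125 * bA ^ 2 + 178219 * bA ^ 2 * xA) := by linear_combination hrho1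
  have hrho2' : -1331434 - 1992109 * xA + 371161 * bA + 555374 * bA * xA + 119124 * bA ^ 2 + 178219 * bA ^ 2 * xA = 1 + πA * (-1992109 - 2980017 * xA + 555374 * bA + 830808 * bA * xA + 178219 * bA ^ 2 + 266591 * bA ^ 2 * xA) := by linear_combination hrho2
  have h1 : ¬ πA ^ 5 ∣ U - 1 := by
    intro hdvd
    rw [hu1, hrho1', show πA ^ 5 = πA ^ 2 * πA ^ 3 by ring] at hdvd
    exact hone _ 2 ((mul_dvd_mul_iff_left (pow_ne_zero 2 hprime.ne_zero)).mp hdvd)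
  have hq : ¬ πA ^ 5 ∣ U - (1 + πA ^ 2 + πA ^ 3 * (4 - 4 * bA + bA ^ 2)) := by
    intro hdvd
    rw [huq, hrho2', show πA ^ 5 = πA ^ 3 * πA ^ 2 by ring] at hdvd
    exact hone _ 1 ((mul_dvd_mul_iff_left (pow_ne_zero 3 hprime.ne_zero)).mp hdvd)
  have key := not_exists_sq_eq_of_not_pow_five_dvd h2 hnw hres hu h1 hq
  -- the value of `U`
  have hθ'rel : 46 - 24 * (bA : ↥(ℚ⟮θ⟯ ⊔ (CyclotomicZp.zpExtension 2).layer 1)) - (bA : ↥(ℚ⟮θ⟯ ⊔ (CyclotomicZp.zpExtension 2).layer 1)) ^ 2 + (bA : ↥(ℚ⟮θ⟯ ⊔ (CyclotomicZp.zpExtension 2).layer 1)) ^ 3 = 0 := by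
    have h := congrArg (algebraMap (𝓞 ↥(ℚ⟮θ⟯ ⊔ (CyclotomicZp.zpExtension 2).layer 1)) ↥(ℚ⟮θ⟯ ⊔ (CyclotomicZp.zpExtension 2).layer 1)) RbA
    simp only [map_add, map_sub, map_mul, map_pow, map_zero, map_ofNat, map_zero, map_neg, map_one] at h; exact h
  have hsx : (2 * (xA : ↥(ℚ⟮θ⟯ ⊔ (CyclotomicZp.zpExtension 2).layer 1)) - (bA : ↥(ℚ⟮θ⟯ ⊔ (CyclotomicZp.zpExtension 2).layer 1)) * (xA : ↥(ℚ⟮θ⟯ ⊔ (CyclotomicZp.zpExtension 2).layer 1))) =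
      ⟨t, (le_sup_right : (CyclotomicZp.zpExtension 2).layer 1 ≤ _) ht⟩ := by
    rw [← hsAval, ← hs]; push_cast [NumberField.RingOfIntegers.coe_eq_algebraMap, map_ofNat]; ring
  have hU : ((U : 𝓞 ↥(ℚ⟮θ⟯ ⊔ (CyclotomicZp.zpExtension 2).layer 1)) : ↥(ℚ⟮θ⟯ ⊔ (CyclotomicZp.zpExtension 2).layer 1)) =
      inclusion (le_sup_left : ℚ⟮θ⟯ ≤ ℚ⟮θ⟯ ⊔ (CyclotomicZp.zpExtension 2).layer 1) (-387137 + 110309 * AdjoinSimple.gen ℚ θ + 35093 * AdjoinSimple.gen ℚ θ ^ 2) + ⟨t, (le_sup_right : (CyclotomicZp.zpExtension 2).layer 1 ≤ _) ht⟩ * inclusion (le_sup_left : ℚ⟮θ⟯ ≤ ℚ⟮θ⟯ ⊔ (CyclotomicZp.zpExtension 2).layer 1) (288637 - 78774 * AdjoinSimple.gen ℚ θ - 25503 * AdjoinSimple.gen ℚ θ ^ 2) := by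
    rw [hUdef, ← hsx]
    simp only [map_add, map_sub, map_mul, map_pow, map_zero, map_neg, map_one, map_ofNat, ← hbAval]
    linear_combination ((-25503 : ↥(ℚ⟮θ⟯ ⊔ (CyclotomicZp.zpExtension 2).layer 1)) * (xA : ↥(ℚ⟮θ⟯ ⊔ (CyclotomicZp.zpExtension 2).layer 1))) * hθ'rel
  rintro ⟨c, hc⟩
  refine key ⟨c, ?_⟩
  apply NumberField.RingOfIntegers.coe_injective
  rw [map_pow, ← NumberField.RingOfIntegers.coe_eq_algebraMap, ← NumberField.RingOfIntegers.coe_eq_algebraMap, hc, hU]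

/-- **`u₊` is not the square of a UNIT of `A₁`** (unit form of the previous statement, for the `#(U⁺/U²)` count).
[cite: Omeara1963, §63A (63:1a)] [cite: FrohlichTaylor1990, Ch. V §1 (1.12), p. 164] -/
theorem not_exists_unit_sq_eq_uplus_sup_layer_one_d18796 (hθ : aeval θ (Cubic.toPoly ⟨1, ((-1 : ℤ) : ℚ), ((-24 : ℤ) : ℚ), ((46 : ℤ) : ℚ)⟩) = 0)
    {t : AlgebraicClosure ℚ} (ht : t ∈ (CyclotomicZp.zpExtension 2).layer 1) (ht2 : t ^ 2 = 2)
    (e : haveI : FiniteDimensional ℚ ↥ℚ⟮θ⟯ :=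
        IntermediateField.adjoin.finiteDimensional ⟨_, Cubic.monic_of_a_eq_one', by rwa [← aeval_def]⟩
      haveI : FiniteDimensional ℚ ↥((CyclotomicZp.zpExtension 2).layer 1) :=
        (CyclotomicZp.zpExtension 2).finiteDimensional_layer_holds 1
      (𝓞 ↥(ℚ⟮θ⟯ ⊔ (CyclotomicZp.zpExtension 2).layer 1))ˣ)
    (he : ((e : 𝓞 ↥(ℚ⟮θ⟯ ⊔ (CyclotomicZp.zpExtension 2).layer 1)) : ↥(ℚ⟮θ⟯ ⊔ (CyclotomicZp.zpExtension 2).layer 1)) =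
      inclusion (le_sup_left : ℚ⟮θ⟯ ≤ ℚ⟮θ⟯ ⊔ (CyclotomicZp.zpExtension 2).layer 1) (-387137 + 110309 * AdjoinSimple.gen ℚ θ + 35093 * AdjoinSimple.gen ℚ θ ^ 2) + ⟨t, (le_sup_right : (CyclotomicZp.zpExtension 2).layer 1 ≤ _) ht⟩ * inclusion (le_sup_left : ℚ⟮θ⟯ ≤ ℚ⟮θ⟯ ⊔ (CyclotomicZp.zpExtension 2).layer 1) (288637 - 78774 * AdjoinSimple.gen ℚ θ - 25503 * AdjoinSimple.gen ℚ θ ^ 2)) :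
    ¬ ∃ w : (𝓞 ↥(ℚ⟮θ⟯ ⊔ (CyclotomicZp.zpExtension 2).layer 1))ˣ, e = w ^ 2 := by
  rintro ⟨w, hw⟩
  refine not_exists_sq_eq_uplus_sup_layer_one_d18796 hθ ht ht2 ⟨(w : 𝓞 ↥(ℚ⟮θ⟯ ⊔ (CyclotomicZp.zpExtension 2).layer 1)), ?_⟩
  rw [← he, hw, Units.val_pow_eq_pow_val]; push_cast; ring

end Summit.BirchSwinnertonDyer.BirchSwinnertonDyer.Theorems.AddKatoTwo

end
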